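import Summits.MatrixMultiplication.MatrixMultiplication.Theorems.SoloInformedNearRectPins

/-!
# THEOREM 8.20, Steps 1–2 in threshold form: pair typing, the 8.16′ move, third-row kinds

This work, §8.8 (T12)(f) Steps 1–2 and C3-m2 §5.5 (gen 107). Setting: a CU13-Def-12 realization of `⟨n,n,n⟩` in
`𝒮(S⁰ × S¹, ±)` [CohnUmans2013, arXiv:1207.6528, Def. 12] — equation data `D : Data ι G` (no 2-torsion), a chart
`Φ`, full separation, class map `κ : G → R` (`r = |R|`).

Every arrow "near-constant ⟹ near-constant, else DONE" of Steps 1–2 of THEOREM 8.20 is stated here with an explicit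
threshold, as a disjunction BOUND ∨ STRUCTURE:
* `Data.pair_typed` (STEP 1): two rows `j, j′` of `b` class-constant (`w″`, `w`) on a common cell `Ks`: either
  `n·t·|Ks| ≤ r·|S⁰|`, or the pair is TYPED off `< t` rows — type X (`w″ ≁ w`; `a(·,j) ∼ w`, `a(·,j′) ∼ w″`) or
  type L (`w″ ∼ w`; the two `a`-columns agree in class) [`Data.card_mul_le_of_two_rows_gen`];
* `Data.cols_move` (THE 8.16′ MOVE): two columns of `a` class-constant (`α ≁ α′`) on `Is`: either `n·t′·|Is| ≤ r·|S⁰|`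
  or, off `< t′` columns, `b(j′,·) ∼ α` and `b(j,·) ∼ α′` [`Data.card_mul_le_of_two_cols`];
* `Data.third_row_kind` (STEP 2, the third-row class chase of C3-m2 §5.4 (v)): given an X-pair `j₁, j₂`
  (`a(·,j₁) ≈ [v′]`, `a(·,j₂) ≈ [v]`, `b(j₁,·) ≈ [v]`, `v ≁ v′`) and a third row `j″` with a common cell with `j₁`,
  either one of two explicit bounds holds or `j″` is of KIND 𝓧 (`a(·,j″) ≈ [v]`, `b(j″,·) ≈ [v′]`) or of KIND 𝓛
  (`a(·,j″) ≈ [v′]`, `b(j″,·) ≈ [v]`) — the chase is shorter than on paper: once the `a`-column of `j″` is typed, the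
  8.16′ move against `j₁` (kind 𝓧) or `j₂` (kind 𝓛) types its `b`-row directly.
The kinds are exactly the line data that `Data.nearRect` (THEOREM 8.19) consumes.
-/

namespace Summit.MatrixMultiplication.MatrixMultiplication.Theorems.TwistedTPP

namespace FibreLines

variable {ι G : Type*} [AddCommGroup G]
variable {G₀ : Type*} [AddCommGroup G₀] {R : Type*}

/-- **STEP 1 (pair typing, threshold form).** [this work, §8.8 (T12)(f) Step 1; C3-m2 §5.5] -/
theorem Data.pair_typed [Fintype ι] [DecidableEq ι] [Fintype G₀] [DecidableEq G₀] [Fintype R]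
    [DecidableEq R] (hG : ∀ x : G, x = -x → x = 0) (D : Data ι G) (Φ : Chart ι G₀) (κ : G → R)
    (hκ : ∀ x y, κ x = κ y → SignEq x y) (hsep : D.SepAll Φ) {j j' : ι} {w'' w : G} (Ks : Finset ι)
    (hj : ∀ k ∈ Ks, SignEq (D.b j k) w'') (hj' : ∀ k ∈ Ks, SignEq (D.b j' k) w) (t : ℕ) :
    Fintype.card ι * t * Ks.card ≤ Fintype.card R * Fintype.card G₀ ∨
      ∃ Ig : Finset ι, Fintype.card ι < Ig.card + t ∧
        ((¬ SignEq w'' w ∧ ∀ i ∈ Ig, SignEq (D.a i j) w ∧ SignEq (D.a i j') w'') ∨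
          (SignEq w'' w ∧ ∀ i ∈ Ig, SignEq (D.a i j) (D.a i j'))) := by
  classical
  set P : ι → Prop := fun i =>
    (SignEq w'' w ∧ SignEq (D.a i j) (D.a i j')) ∨ (SignEq w'' (D.a i j') ∧ SignEq w (D.a i j)) with hP
  set I₁ : Finset ι := Finset.univ.filter fun i => ¬ P i with hI₁
  have hb := D.card_mul_le_of_two_rows_gen hG Φ κ hκ hsep I₁ Ks hj hj'
    (fun i hi h => (Finset.mem_filter.1 hi).2 (Or.inl h)) (fun i hi h => (Finset.mem_filter.1 hi).2 (Or.inr h))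
  by_cases ht : t ≤ I₁.card
  · left
    exact (Nat.mul_le_mul_right _ (Nat.mul_le_mul_left _ ht)).trans hb
  · right
    push Not at ht
    set Ig : Finset ι := Finset.univ.filter fun i => P i with hIg
    have hsplit : Ig.card + I₁.card = Fintype.card ι := by
      rw [← Finset.card_univ]; exact Finset.card_filter_add_card_filter_not _
    refine ⟨Ig, by omega, ?_⟩
    by_cases hw : SignEq w'' w
    · right
      refine ⟨hw, fun i hi => ?_⟩
      rcases (Finset.mem_filter.1 hi).2 with h | h
      · exact h.2
      · exact h.2.symm.trans (hw.symm.trans h.1)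
    · left
      refine ⟨hw, fun i hi => ?_⟩
      rcases (Finset.mem_filter.1 hi).2 with h | h
      · exact absurd h.1 hw
      · exact ⟨h.2.symm, h.1.symm⟩

/-- **THE 8.16′ MOVE (threshold form).** [this work, §8.8 (T12)(f) Step 2; C3-m2 §5.5] -/
theorem Data.cols_move [Fintype ι] [DecidableEq ι] [Fintype G₀] [DecidableEq G₀] [Fintype R]
    [DecidableEq R] (hG : ∀ x : G, x = -x → x = 0) (D : Data ι G) (Φ : Chart ι G₀) (κ : G → R)
    (hκ : ∀ x y, κ x = κ y → SignEq x y) (hsep : D.SepAll Φ) {j j' : ι} {α α' : G}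
    (hαα : ¬ SignEq α α') (Is : Finset ι) (hj : ∀ i ∈ Is, SignEq (D.a i j) α)
    (hj' : ∀ i ∈ Is, SignEq (D.a i j') α') (t' : ℕ) :
    Fintype.card ι * t' * Is.card ≤ Fintype.card R * Fintype.card G₀ ∨
      ∃ Kg : Finset ι, Fintype.card ι < Kg.card + t' ∧
        ∀ k ∈ Kg, SignEq (D.b j' k) α ∧ SignEq (D.b j k) α' := by
  classical
  set K₁ : Finset ι := Finset.univ.filter fun k => ¬ (SignEq α (D.b j' k) ∧ SignEq α' (D.b j k)) with hK₁
  have hb := D.card_mul_le_of_two_cols hG Φ κ hκ hsep hαα Is K₁ hj hj' fun k hk => (Finset.mem_filter.1 hk).2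
  by_cases ht : t' ≤ K₁.card
  · left
    exact (Nat.mul_le_mul_right _ (Nat.mul_le_mul_left _ ht)).trans hb
  · right
    push Not at ht
    set Kg : Finset ι := Finset.univ.filter fun k => SignEq α (D.b j' k) ∧ SignEq α' (D.b j k) with hKg
    have hsplit : Kg.card + K₁.card = Fintype.card ι := by
      rw [← Finset.card_univ]; exact Finset.card_filter_add_card_filter_not _
    exact ⟨Kg, by omega, fun k hk =>
      ⟨(Finset.mem_filter.1 hk).2.1.symm, (Finset.mem_filter.1 hk).2.2.symm⟩⟩

/-- **STEP 2: the kind of a third row against an X-pair (threshold form).** `j₁, j₂` an X-pair: off the rows `E`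
(`|E| ≤ e`) `a(·,j₁) ∼ v′` and `a(·,j₂) ∼ v`; off the columns `F` (`|F| ≤ e`) `b(j₁,·) ∼ v`; `v ≁ v′`. A third row
`j″` class-constant together with `j₁` on a common cell `Ks` (`|Ks| > e`) satisfies a BOUND, or is of KIND 𝓧
(`a(·,j″) ∼ v` and `b(j″,·) ∼ v′` off few lines) or of KIND 𝓛 (`a(·,j″) ∼ v′`, `b(j″,·) ∼ v`).
[this work, §8.8 (T12)(f) Step 2; C3-m2 §5.4 (v), §5.5] -/
theorem Data.third_row_kind [Fintype ι] [DecidableEq ι] [Fintype G₀] [DecidableEq G₀] [Fintype R]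
    [DecidableEq R] (hG : ∀ x : G, x = -x → x = 0) (D : Data ι G) (Φ : Chart ι G₀) (κ : G → R)
    (hκ : ∀ x y, κ x = κ y → SignEq x y) (hsep : D.SepAll Φ) {j₁ j₂ j'' : ι} {v v' w'' w : G}
    (hvv : ¬ SignEq v v') (E F Ks : Finset ι) (e t t' : ℕ) (hE : E.card ≤ e) (hF : F.card ≤ e)
    (ha₁ : ∀ i, i ∉ E → SignEq (D.a i j₁) v') (ha₂ : ∀ i, i ∉ E → SignEq (D.a i j₂) v)
    (hb₁ : ∀ k, k ∉ F → SignEq (D.b j₁ k) v) (hKs : e < Ks.card)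
    (hj'' : ∀ k ∈ Ks, SignEq (D.b j'' k) w'') (hj₁ : ∀ k ∈ Ks, SignEq (D.b j₁ k) w) :
    Fintype.card ι * t * Ks.card ≤ Fintype.card R * Fintype.card G₀ ∨
    Fintype.card ι * t' * (Fintype.card ι - t - e) ≤ Fintype.card R * Fintype.card G₀ ∨
    (∃ Ig Kg : Finset ι, Fintype.card ι ≤ Ig.card + t + e ∧ Fintype.card ι < Kg.card + t' ∧
      (∀ i ∈ Ig, SignEq (D.a i j'') v) ∧ ∀ k ∈ Kg, SignEq (D.b j'' k) v') ∨
    (∃ Ig Kg : Finset ι, Fintype.card ι ≤ Ig.card + t + e ∧ Fintype.card ι < Kg.card + t' ∧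
      (∀ i ∈ Ig, SignEq (D.a i j'') v') ∧ ∀ k ∈ Kg, SignEq (D.b j'' k) v) := by
  classical
  -- the cell class of row `j₁` is `∼ v`
  have hwv : SignEq w v := by
    obtain ⟨k, hk, hkF⟩ := Finset.exists_mem_notMem_of_card_lt_card (s := F) (t := Ks) (by omega)
    exact (hj₁ k hk).symm.trans (hb₁ k hkF)
  rcases D.pair_typed hG Φ κ hκ hsep Ks hj'' hj₁ t with hb | ⟨Ig, hIg, hX | hL⟩
  · exact Or.inl hb
  · -- type X against `j₁`: `a(·,j″) ∼ w ∼ v`; the 8.16′ move against `j₁` types the `b`-row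
    have hIs : Fintype.card ι ≤ (Ig \ E).card + t + e := by
      have := Finset.card_le_card_sdiff_add_card (s := Ig) (t := E); omega
    have hja : ∀ i ∈ Ig \ E, SignEq (D.a i j'') v := fun i hi =>
      ((hX.2 i (Finset.mem_sdiff.1 hi).1).1).trans hwv
    rcases D.cols_move hG Φ κ hκ hsep hvv (Ig \ E) hja
      (fun i hi => ha₁ i (Finset.mem_sdiff.1 hi).2) t' with hb | ⟨Kg, hKg, hKb⟩
    · right; left
      refine le_trans (Nat.mul_le_mul_left _ ?_) hb
      omega
    · right; right; left
      exact ⟨Ig \ E, Kg, hIs, hKg, hja, fun k hk => (hKb k hk).2⟩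
  · -- type L against `j₁`: `a(·,j″) ∼ a(·,j₁) ∼ v′`; the 8.16′ move against `j₂` types the `b`-row
    have hIs : Fintype.card ι ≤ (Ig \ E).card + t + e := by
      have := Finset.card_le_card_sdiff_add_card (s := Ig) (t := E); omega
    have hja : ∀ i ∈ Ig \ E, SignEq (D.a i j'') v' := fun i hi =>
      (hL.2 i (Finset.mem_sdiff.1 hi).1).trans (ha₁ i (Finset.mem_sdiff.1 hi).2)
    rcases D.cols_move hG Φ κ hκ hsep (fun h => hvv h.symm) (Ig \ E) hja
      (fun i hi => ha₂ i (Finset.mem_sdiff.1 hi).2) t' with hb | ⟨Kg, hKg, hKb⟩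
    · right; left
      refine le_trans (Nat.mul_le_mul_left _ ?_) hb
      omega
    · right; right; right
      exact ⟨Ig \ E, Kg, hIs, hKg, hja, fun k hk => (hKb k hk).2⟩

end FibreLines

end Summit.MatrixMultiplication.MatrixMultiplication.Theorems.TwistedTPP
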